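import Summits.KontsevichZagierPeriods.KontsevichZagierPeriods.Theorems.LinRedNormalFormArrangementNormalFormStubRebaseSimplePosOneFibreParThin
import Summits.KontsevichZagierPeriods.KontsevichZagierPeriods.Theorems.LinRedNormalFormArrangementNormalFormStubRebaseSimplePosOneFibreParThick

/-!
# Stub `stub_rebaseSimplePosOne`, residual hypothesis `Hpar` (crux `ArrangementNormalForm`,
line `janus-bands`, v6.2) — sub-part `ParNear`

**THIN parallel bands, sub-case (B2) over a non-pinching product cell**: the base pole `ℓ₂(x')`
lies on the NEAR side of the `y`-range (`yhi ≤ ℓ₂` if `s > 0`, `ℓ₂ ≤ ylo` if `s < 0`), so that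
after the shear `t' = t − u(x', y)` the distinguished coordinate `y` lies strictly BETWEEN the pole
`ℓ₂` and the sheared letter `τ = −(t' + u₀)/s`. Then the partial fractions
`1/((y − ℓ₂)(y − τ)) = (1/(ℓ₂ − τ)) (1/(y − ℓ₂) − 1/(y − τ))` are DOMINATED (rule 1b; both
multipliers `(y − τ)/(ℓ₂ − τ)`, `(ℓ₂ − y)/(ℓ₂ − τ)` have absolute value `≤ 1`,
`SeparatePos.mulRep`), and:
* the first piece `R(x')/(t' + κ'(x')) · 1/(y − ℓ₂)` (`κ' = u₀ + s ℓ₂`) is LITERALLY in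
  `GG B 2 1` (letter `−κ'` and bounds `0`, `w` of `t'` all `y`-free);
* the second piece `−R(x')/(t' + κ') · 1/(y − τ)` has no base pole in `y`: RE-SELECT `t'` as the
  distinguished base coordinate and `y` as the fibre (a coordinate swap, rule 2): over the base
  `(x', t')` it is a one-fibre literal datum with base pole `1/(t' + κ')`, letter `τ` (slope
  `−1/s`) and `t'`-free bounds `ylo(x') < y < yhi(x')` (this needs the PRODUCT structure of the
  cell, `hsec`) — a PARALLEL band of width `yhi − ylo ≥ η`, i.e. THICK: shear (and reflect if
  `s < 0`) the letter to `0` (`RebasePos.pull`) and conclude by `RebasePos.good_parThick`.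
Registered as `rebaseSimplePos_par_thin_near`. Together with `rebaseSimplePos_par_thick` and
`rebaseSimplePos_par_thin_exchange` this closes `Hpar` over NON-PINCHING product cells; the
pinching `y`-ranges are the remaining residue.

References: M. Kontsevich, D. Zagier, *Periods* (2001), §1.2, rules (1b), (2).
-/

noncomputable section

open Set MeasureTheory MvPolynomial
open Literature.NumberTheory.Transcendental Literature.ModelTheory.ExponentialFields

namespace Summit.KontsevichZagierPeriods.ArrangementNormalForm.JanusBands

namespace RebasePos

open SeparatePos IntegrateOut

section Near

variable {B m m' m₀ : ℕ} (L : Fin m → (Fin B → ℚ) × ℚ) (e : Fin m → ℕ) (ℓ₁ ℓ₂ : (Fin B → ℚ) × ℚ)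

/-- **THIN parallel bands, sub-case (B2), non-pinching product cell.** See the module docstring. -/
theorem good_parNear (s : KZ.IntegralRep (B + 1 + 1)) (M : Fin m' → (Fin (B + 1) → ℚ) × ℚ)
    (M₀ : Fin m₀ → (Fin B → ℚ) × ℚ) (ylo yhi : (Fin B → ℚ) × ℚ) (p : MvPolynomial (Fin B) ℚ)
    (u v : (Fin (B + 1) → ℚ) × ℚ) (hbd : Bornology.IsBounded s.domain)
    (hdom : s.domain = gDom B 1 m' M (fun _ => Sum.inr u) (fun _ => Sum.inr v))
    (hint : EqOn s.integrand (glit B 1 p L e ℓ₁ ℓ₂ 0 1 (fun _ => some 0)) s.domain)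
    (hu : u.1 (Fin.last B) ≠ 0) (hpar : u.1 (Fin.last B) = v.1 (Fin.last B))
    (hcell : ∀ z : Fin (B + 1 + 1) → ℝ, (∀ j, 0 < affF B 1 (M j) z) → 0 < affF B 1 u z ∧ affF B 1 u z < affF B 1 v z)
    (hsec : ∀ z : Fin (B + 1 + 1) → ℝ, (∀ j, 0 < affF B 1 (M j) z) ↔ ((∀ j, 0 < affB B 1 (M₀ j) z) ∧
      affB B 1 ylo z < z (Fin.castAdd 1 (Fin.last B)) ∧ z (Fin.castAdd 1 (Fin.last B)) < affB B 1 yhi z))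
    (hη : ∃ η : ℝ, 0 < η ∧ ∀ z : Fin (B + 1 + 1) → ℝ, (∀ j, 0 < affB B 1 (M₀ j) z) →
      η ≤ affB B 1 yhi z - affB B 1 ylo z)
    (hnear : ∀ z : Fin (B + 1 + 1) → ℝ, (∀ j, 0 < affB B 1 (M₀ j) z) →
      (0 < u.1 (Fin.last B) → affB B 1 yhi z ≤ affB B 1 ℓ₂ z) ∧ (u.1 (Fin.last B) < 0 → affB B 1 ℓ₂ z ≤ affB B 1 ylo z)) :
    ∃ c ∈ AddSubgroup.closure (GGset B 2 1), KZ.of s - c ∈ KZ.relations := by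
  obtain ⟨η, hη0, hη'⟩ := hη
  have hne : ∀ z : Fin (B + 1 + 1) → ℝ, (∀ j, 0 < affB B 1 (M₀ j) z) → affB B 1 ylo z < affB B 1 yhi z :=
    fun z hz => by have := hη' z hz; linarith
  have hfl : ∀ z : Fin (B + 1 + 1) → ℝ, (∀ j, 0 < affB B 1 (M₀ j) z) →
      (0 < u.1 (Fin.last B) → 0 ≤ (u.1 (Fin.last B) : ℝ) * affB B 1 ylo z + affB B 1 (restr B u) z) ∧
      (u.1 (Fin.last B) < 0 → 0 ≤ (u.1 (Fin.last B) : ℝ) * affB B 1 yhi z + affB B 1 (restr B u) z) :=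
    fun z hz => floor_of_pos M M₀ ylo yhi u (fun z hz => (hcell z hz).1) hsec hne z hz
  set sR : ℝ := (u.1 (Fin.last B) : ℝ) with hsR
  have hs' : sR ≠ 0 := by rw [hsR]; exact_mod_cast hu
  have hs'' : ((u.1 (Fin.last B) : ℚ) : ℝ) ≠ 0 := by exact_mod_cast hu
  -- (1) shear `t' = t − u(x', y)`
  obtain ⟨s₁, -, hbd₁, hdom₁, hint₁, hrel₁⟩ := pull (fun _ : Fin 1 => (1 : ℚ)) (fun _ => u.1 (Fin.last B))
    (fun _ => restr B u) s M L e p ℓ₁ ℓ₂ 0 1 (fun _ => some 0) (fun _ => Sum.inr u) (fun _ => Sum.inr v) hbd hdom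
    hint (fun _ => one_ne_zero) (fun i j hij => by rcases hij with h | h <;> cases h)
  set wd : (Fin (B + 1) → ℚ) × ℚ := v - u with hwd
  have hwd0 : wd.1 (Fin.last B) = 0 := by rw [hwd]; simp [hpar]
  have h01 : (0 : ℚ) < 1 := one_pos
  have hlo₁ : pullLo (fun _ : Fin 1 => (1 : ℚ)) (fun _ => u.1 (Fin.last B)) (fun _ => restr B u)
      (fun _ => Sum.inr u) (fun _ => Sum.inr v) = fun _ => Sum.inr 0 := by
    funext i; simp [pullLo, h01, pullC_one_restr]
  have hhi₁ : pullHi (fun _ : Fin 1 => (1 : ℚ)) (fun _ => u.1 (Fin.last B)) (fun _ => restr B u)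
      (fun _ => Sum.inr u) (fun _ => Sum.inr v) = fun _ => Sum.inr wd := by
    funext i; simp [pullHi, h01, pullC_one_restr, hwd]
  have ha₁ : pullA (fun _ : Fin 1 => (1 : ℚ)) (fun _ => u.1 (Fin.last B)) (fun _ => restr B u)
      (fun _ => some (0 : (Fin (B + 1) → ℚ) × ℚ)) = fun _ => some (-u) := by
    funext i; simp [pullA, pullC_one_restr]
  rw [hlo₁, hhi₁] at hdom₁
  rw [ha₁] at hint₁
  set p₃ := MvPolynomial.C (pullQ (fun _ : Fin 1 => (1 : ℚ)) (fun _ => some (0 : (Fin (B + 1) → ℚ) × ℚ))) * p with hp₃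
  suffices hs₁ : ∃ c ∈ AddSubgroup.closure (GGset B 2 1), KZ.of s₁ - c ∈ KZ.relations by
    obtain ⟨c₀, hc₀, hc₀'⟩ := hs₁
    exact ⟨c₀, hc₀, by have := add_mem hrel₁ hc₀'; rwa [sub_add_sub_cancel] at this⟩
  have hwdv : ∀ z : Fin (B + 1 + 1) → ℝ, affF B 1 wd z = affB B 1 (restr B wd) z := fun z => affF_yfree wd hwd0 z
  have hmem₁ : ∀ z, z ∈ s₁.domain ↔ (∀ j, 0 < affF B 1 (M j) z) ∧ 0 < z (Fin.natAdd (B + 1) 0) ∧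
      z (Fin.natAdd (B + 1) 0) < affB B 1 (restr B wd) z := fun z => by rw [hdom₁, mem_gDom_one, affF_zero'', hwdv]
  -- (2) the quantities `y − τ`, `ℓ₂ − y`, `ℓ₂ − τ` on the sheared band
  set yv : (Fin (B + 1 + 1) → ℝ) → ℝ := fun z => z (Fin.castAdd 1 (Fin.last B)) with hyv
  set tv : (Fin (B + 1 + 1) → ℝ) → ℝ := fun z => z (Fin.natAdd (B + 1) 0) with htv
  set τv : (Fin (B + 1 + 1) → ℝ) → ℝ := fun z => -(tv z + affB B 1 (restr B u) z) / sR with hτv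
  set G : (Fin (B + 1 + 1) → ℝ) → ℝ := fun q =>
    MvPolynomial.aeval (fun i => q (Fin.castAdd 1 (Fin.castSucc i))) p₃ / ∏ j, (affB B 1 (L j) q) ^ e j with hG
  have hGw : ∀ w : Fin (B + 1 + 1) → ℝ,
      MvPolynomial.aeval (fun i => w (Fin.castAdd 1 (Fin.castSucc i))) p₃ / ∏ j, (affB B 1 (L j) w) ^ e j = G w :=
    fun w => rfl
  have hfacts : ∀ z ∈ s₁.domain, 0 < (yv z - τv z) * (affB B 1 ℓ₂ z - yv z) ∧ 0 < tv z ∧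
      (0 < sR → 0 < yv z - τv z ∧ 0 < affB B 1 ℓ₂ z - yv z) ∧ (sR < 0 → yv z - τv z < 0 ∧ affB B 1 ℓ₂ z - yv z < 0) := by
    intro z hz
    obtain ⟨hrows, ht0, _⟩ := (hmem₁ z).1 hz
    obtain ⟨h0, hylo, hyhi⟩ := (hsec z).1 hrows
    have hupos := (hcell z hrows).1
    rw [affF_split u z] at hupos
    have hyτ : yv z - τv z = (tv z + ((u.1 (Fin.last B) : ℝ) * yv z + affB B 1 (restr B u) z)) / sR := by
      simp only [hτv, hyv, htv, hsR]; field_simp; ring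
    rcases lt_or_gt_of_ne hu with hn | hp
    · have hsn : sR < 0 := by rw [hsR]; exact_mod_cast hn
      have h1 : yv z - τv z < 0 := by rw [hyτ]; exact div_neg_of_pos_of_neg (by simp only [hyv, htv]; linarith) hsn
      have h2 : affB B 1 ℓ₂ z - yv z < 0 := by have := (hnear z h0).2 hn; simp only [hyv]; linarith
      exact ⟨mul_pos_of_neg_of_neg h1 h2, ht0, fun h => absurd h (not_lt.2 hsn.le), fun _ => ⟨h1, h2⟩⟩
    · have hsp : 0 < sR := by rw [hsR]; exact_mod_cast hp
      have h1 : 0 < yv z - τv z := by rw [hyτ]; exact div_pos (by simp only [hyv, htv]; linarith) hsp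
      have h2 : 0 < affB B 1 ℓ₂ z - yv z := by have := (hnear z h0).1 hp; simp only [hyv]; linarith
      exact ⟨mul_pos h1 h2, ht0, fun _ => ⟨h1, h2⟩, fun h => absurd h (not_lt.2 hsp.le)⟩
  have hℓτ : ∀ z ∈ s₁.domain, affB B 1 ℓ₂ z - τv z ≠ 0 ∧ |yv z - τv z| ≤ |affB B 1 ℓ₂ z - τv z| ∧
      |affB B 1 ℓ₂ z - yv z| ≤ |affB B 1 ℓ₂ z - τv z| := by
    intro z hz
    obtain ⟨-, -, hp, hn⟩ := hfacts z hz
    have hsum : affB B 1 ℓ₂ z - τv z = (yv z - τv z) + (affB B 1 ℓ₂ z - yv z) := by ring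
    rcases lt_or_gt_of_ne hs' with h | h
    · obtain ⟨h1, h2⟩ := hn h
      rw [hsum, abs_of_neg h1, abs_of_neg h2, abs_of_neg (by linarith)]
      exact ⟨by linarith, by linarith, by linarith⟩
    · obtain ⟨h1, h2⟩ := hp h
      rw [hsum, abs_of_pos h1, abs_of_pos h2, abs_of_pos (by linarith)]
      exact ⟨by linarith, by linarith, by linarith⟩
  -- the sheared integrand
  have hκ : ∀ z, affB B 1 ℓ₂ z - τv z = (tv z + (affB B 1 (restr B u) z + sR * affB B 1 ℓ₂ z)) / sR := fun z => by
    simp only [hτv]; field_simp; ring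
  have key : ∀ z ∈ s₁.domain, s₁.integrand z = G z / sR / ((yv z - affB B 1 ℓ₂ z) * (yv z - τv z)) := by
    intro z hz
    have h3 : z (Fin.natAdd (B + 1) 0) - affF B 1 (-u) z = sR * (z (Fin.castAdd 1 (Fin.last B)) - τv z) := by
      rw [affF_neg', affF_split u z]; simp only [hτv, htv, hsR]; field_simp; ring
    have hp := (hfacts z hz).1
    simp only [hyv] at hp
    have hne1 : z (Fin.castAdd 1 (Fin.last B)) - τv z ≠ 0 := fun h => by
      rw [h, zero_mul] at hp; exact lt_irrefl _ hp
    have hne2 : z (Fin.castAdd 1 (Fin.last B)) - affB B 1 ℓ₂ z ≠ 0 := fun h => by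
      rw [show affB B 1 ℓ₂ z - z (Fin.castAdd 1 (Fin.last B)) = -(z (Fin.castAdd 1 (Fin.last B)) - affB B 1 ℓ₂ z) by ring,
        h, neg_zero, mul_zero] at hp; exact lt_irrefl _ hp
    rw [hint₁ hz, glit_one, pow_zero, pow_one, h3, hG, hyv]
    field_simp
  -- (3) the two dominated multipliers
  set m₁ : (Fin (B + 1 + 1) → ℝ) → ℝ := fun z => (yv z - τv z) / (affB B 1 ℓ₂ z - τv z) with hm₁
  set m₂ : (Fin (B + 1 + 1) → ℝ) → ℝ := fun z => (affB B 1 ℓ₂ z - yv z) / (affB B 1 ℓ₂ z - τv z) with hm₂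
  have hτS : IsSemialgebraicFunOn ℚ s₁.domain τv :=
    isSemialgebraicFunOn_div (IsSemialgebraicFunOn.add_holds (isSemialgebraicFunOn_apply s₁.isSemialgebraic_domain _)
      (isSemialgebraicFunOn_affB' (restr B u) s₁.isSemialgebraic_domain)).neg
      (isSemialgebraicFunOn_ratCast s₁.isSemialgebraic_domain (u.1 (Fin.last B)))
  have hyS : IsSemialgebraicFunOn ℚ s₁.domain yv := isSemialgebraicFunOn_apply s₁.isSemialgebraic_domain _
  have hℓS : IsSemialgebraicFunOn ℚ s₁.domain (affB B 1 ℓ₂) := isSemialgebraicFunOn_affB' ℓ₂ s₁.isSemialgebraic_domain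
  have hm₁S : IsSemialgebraicFunOn ℚ s₁.domain m₁ :=
    isSemialgebraicFunOn_div (IsSemialgebraicFunOn.sub_holds hyS hτS) (IsSemialgebraicFunOn.sub_holds hℓS hτS)
  have hm₂S : IsSemialgebraicFunOn ℚ s₁.domain m₂ :=
    isSemialgebraicFunOn_div (IsSemialgebraicFunOn.sub_holds hℓS hyS) (IsSemialgebraicFunOn.sub_holds hℓS hτS)
  have hC₁ : ∀ z ∈ s₁.domain, |m₁ z| ≤ 1 := fun z hz => by
    obtain ⟨h0, h1, -⟩ := hℓτ z hz
    rw [hm₁]; dsimp only; rw [abs_div, div_le_one (abs_pos.2 h0)]; exact h1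
  have hC₂ : ∀ z ∈ s₁.domain, |m₂ z| ≤ 1 := fun z hz => by
    obtain ⟨h0, -, h2⟩ := hℓτ z hz
    rw [hm₂]; dsimp only; rw [abs_div, div_le_one (abs_pos.2 h0)]; exact h2
  set V₁ := mulRep s₁ m₁ hm₁S 1 hC₁ with hV₁
  set V₂ := mulRep s₁ m₂ hm₂S 1 hC₂ with hV₂
  have hsplit : KZ.of s₁ - KZ.of V₁ - KZ.of V₂ ∈ KZ.relations := by
    refine KZ.integrandAddRel_subset_relations ⟨_, s₁, V₁, V₂, rfl, rfl, fun z hz => ?_, rfl⟩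
    have h0 := (hℓτ z hz).1
    show s₁.integrand z = s₁.integrand z * m₁ z + s₁.integrand z * m₂ z
    have h1 : m₁ z + m₂ z = 1 := by
      rw [hm₁, hm₂]; dsimp only; rw [← add_div, div_eq_one_iff_eq h0]; ring
    rw [← mul_add, h1, mul_one]
  -- (4) the first piece is literal
  set κx : (Fin B → ℚ) × ℚ := restr B u - (-u.1 (Fin.last B)) • ℓ₂ with hκx
  have hκxv : ∀ z : Fin (B + 1 + 1) → ℝ, affB B 1 κx z = affB B 1 (restr B u) z + sR * affB B 1 ℓ₂ z := fun z => by
    rw [hκx, affB_sub, affB_smul', hsR]; push_cast; ring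
  set cκ : (Fin (B + 1) → ℚ) × ℚ := ((Fin.snoc (-κx).1 0 : Fin (B + 1) → ℚ), (-κx).2) with hcκ
  have hcκv : ∀ z : Fin (B + 1 + 1) → ℝ, affF B 1 cκ z = -(affB B 1 (restr B u) z + sR * affB B 1 ℓ₂ z) := fun z => by
    rw [hcκ, affF_liftB, affB_neg', hκxv]
  have hV₁i : EqOn V₁.integrand (glit B 1 p₃ L e ℓ₁ ℓ₂ 0 1 (fun _ => some cκ)) V₁.domain := by
    intro z hz
    have hz' : z ∈ s₁.domain := hz
    have h0 := (hℓτ z hz').1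
    have hne1 : yv z - τv z ≠ 0 := fun h => by have := (hfacts z hz').1; rw [h, zero_mul] at this; exact lt_irrefl _ this
    have hne2 : yv z - affB B 1 ℓ₂ z ≠ 0 := fun h => by
      have := (hfacts z hz').1; rw [show affB B 1 ℓ₂ z - yv z = -(yv z - affB B 1 ℓ₂ z) by ring, h, neg_zero,
        mul_zero] at this; exact lt_irrefl _ this
    have hD1 : z (Fin.natAdd (B + 1) 0) - affF B 1 cκ z = sR * (affB B 1 ℓ₂ z - τv z) := by
      rw [hcκv, hκ z]; simp only [htv]; field_simp; ring
    show s₁.integrand z * m₁ z = _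
    rw [key z hz', glit_one, pow_zero, pow_one, hm₁, hGw, hD1]
    simp only [hyv] at hne1 hne2 ⊢
    field_simp
  have hV₁mem : KZ.of V₁ ∈ GGset B 2 1 :=
    mem_GGset_two V₁ M L e p₃ ℓ₁ ℓ₂ (fun _ => some cκ) (fun _ => Sum.inr 0) (fun _ => Sum.inr wd) (Or.inl rfl)
      (fun _ c hc => by cases hc; rw [hcκ]; simp)
      (fun _ c hc => by
        rcases hc with h | h <;> simp only [Sum.inr.injEq] at h <;> subst h
        · exact Or.inl rfl
        · exact Or.inl hwd0)
      hbd₁ hdom₁ hV₁i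
  -- (5) the second piece: swap `y ↔ t'` and read it over the base `(x', t')`
  set e₂ : Fin (B + 1 + 1) ≃ Fin (B + 1 + 1) := Equiv.swap (Fin.castAdd 1 (Fin.last B)) (Fin.natAdd (B + 1) (0 : Fin 1))
    with he₂
  set V₃ := V₂.reindex e₂ with hV₃
  have hrel₂ : KZ.of V₂ - KZ.of V₃ ∈ KZ.relations := IntegrateOut.of_sub_of_reindex_mem_relations V₂ e₂
  -- new literal data over the base `(x', t')`
  set Tf : (Fin (B + 1) → ℚ) × ℚ := ((Fin.snoc (fun i : Fin B => -u.1 (Fin.castSucc i) / u.1 (Fin.last B))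
    (-1 / u.1 (Fin.last B)) : Fin (B + 1) → ℚ), -u.2 / u.1 (Fin.last B)) with hTf
  set ℓκ : (Fin B → ℚ) × ℚ := -κx with hℓκ
  set yloF : (Fin (B + 1) → ℚ) × ℚ := ((Fin.snoc ylo.1 0 : Fin (B + 1) → ℚ), ylo.2) with hyloF
  set yhiF : (Fin (B + 1) → ℚ) × ℚ := ((Fin.snoc yhi.1 0 : Fin (B + 1) → ℚ), yhi.2) with hyhiF
  set rowLo : (Fin (B + 1) → ℚ) × ℚ := ((Fin.snoc (fun i : Fin B => -(0 : (Fin (B + 1) → ℚ) × ℚ).1 (Fin.castSucc i)) 1 :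
    Fin (B + 1) → ℚ), -(0 : (Fin (B + 1) → ℚ) × ℚ).2) with hrowLo
  set rowHi : (Fin (B + 1) → ℚ) × ℚ := ((Fin.snoc (fun i : Fin B => wd.1 (Fin.castSucc i)) (-1) : Fin (B + 1) → ℚ), wd.2)
    with hrowHi
  set M₃ : Fin (m₀ + 2) → (Fin (B + 1) → ℚ) × ℚ :=
    Fin.append (fun j => (((Fin.snoc (M₀ j).1 0 : Fin (B + 1) → ℚ), (M₀ j).2)) : Fin m₀ → _) ![rowLo, rowHi] with hM₃
  have hrows₃ : ∀ w : Fin (B + 1 + 1) → ℝ, (∀ j, 0 < affF B 1 (M₃ j) w) ↔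
      (∀ j, 0 < affB B 1 (M₀ j) w) ∧ 0 < w (Fin.castAdd 1 (Fin.last B)) ∧
        w (Fin.castAdd 1 (Fin.last B)) < affB B 1 (restr B wd) w := by
    intro w
    rw [hM₃, Fin.forall_fin_add, Fin.forall_fin_two]
    simp only [Fin.append_left, Fin.append_right, Matrix.cons_val_zero, Matrix.cons_val_one, affF_liftB, hrowLo, hrowHi,
      affF_rowLo _ (rfl : (0 : (Fin (B + 1) → ℚ) × ℚ).1 (Fin.last B) = 0), affF_rowHi _ hwd0, affF_zero'', sub_zero,
      hwdv, sub_pos]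
  have hcomp : ∀ w : Fin (B + 1 + 1) → ℝ, w (e₂ (Fin.castAdd 1 (Fin.last B))) = w (Fin.natAdd (B + 1) 0) ∧
      w (e₂ (Fin.natAdd (B + 1) 0)) = w (Fin.castAdd 1 (Fin.last B)) := fun w => by
    rw [he₂, Equiv.swap_apply_left, Equiv.swap_apply_right]
    exact ⟨rfl, rfl⟩
  have hTv : ∀ w : Fin (B + 1 + 1) → ℝ, affF B 1 Tf w = -(w (Fin.castAdd 1 (Fin.last B)) + affB B 1 (restr B u) w) / sR :=
    fun w => affF_Tform u w
  have hdom₃ : V₃.domain = gDom B 1 (m₀ + 2) M₃ (fun _ => Sum.inr yloF) (fun _ => Sum.inr yhiF) := by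
    ext w
    rw [hV₃, KZ.IntegralRep.reindex_domain, mem_setOf_eq, mem_gDom_one, hrows₃, hyloF, hyhiF, affF_liftB, affF_liftB]
    show (fun i => w (e₂ i)) ∈ s₁.domain ↔ _
    rw [hmem₁, hsec, (hcomp w).1, (hcomp w).2, he₂]
    simp only [affB_swap_yt]
    tauto
  have hbd₃ : Bornology.IsBounded V₃.domain := by
    obtain ⟨C, hC⟩ := isBounded_iff_forall_norm_le.mp hbd₁
    refine isBounded_iff_forall_norm_le.mpr ⟨C, fun w hw => le_trans ?_ (hC _ hw)⟩
    refine (pi_norm_le_iff_of_nonneg (norm_nonneg _)).mpr fun j => ?_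
    simpa using norm_le_pi_norm (fun i => w (e₂ i)) (e₂.symm j)
  have hint₃ : EqOn V₃.integrand (glit B 1 (MvPolynomial.C (-1 : ℚ) * p₃) L e ℓ₁ ℓκ 0 1 (fun _ => some Tf)) V₃.domain := by
    intro w hw
    have hz : (fun i => w (e₂ i)) ∈ s₁.domain := hw
    set z : Fin (B + 1 + 1) → ℝ := fun i => w (e₂ i) with hzdef
    have h0 := (hℓτ z hz).1
    have hne1 : yv z - τv z ≠ 0 := fun h => by have := (hfacts z hz).1; rw [h, zero_mul] at this; exact lt_irrefl _ this
    have hne2 : yv z - affB B 1 ℓ₂ z ≠ 0 := fun h => by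
      have := (hfacts z hz).1; rw [show affB B 1 ℓ₂ z - yv z = -(yv z - affB B 1 ℓ₂ z) by ring, h, neg_zero,
        mul_zero] at this; exact lt_irrefl _ this
    have hxz : ∀ d : (Fin B → ℚ) × ℚ, affB B 1 d z = affB B 1 d w := fun d => by rw [hzdef, he₂]; exact affB_swap_yt d w
    have hyz : yv z = w (Fin.natAdd (B + 1) 0) := (hcomp w).1
    have htz : tv z = w (Fin.castAdd 1 (Fin.last B)) := (hcomp w).2
    have hx' : (fun i : Fin B => z (Fin.castAdd 1 (Fin.castSucc i))) = fun i => w (Fin.castAdd 1 (Fin.castSucc i)) :=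
      funext fun i => by rw [hzdef, he₂]; exact swap_yt_x w i
    have hGz : G z = G w := by simp only [hG, hxz, hx']
    have hτz : -(w (Fin.castAdd 1 (Fin.last B)) + affB B 1 (restr B u) w) / sR = τv z := by simp only [hτv, htz, hxz]
    have hD : w (Fin.castAdd 1 (Fin.last B)) - -(affB B 1 (restr B u) w + sR * affB B 1 ℓ₂ w) =
        sR * (affB B 1 ℓ₂ w - τv z) := by
      rw [← hτz]; field_simp; ring
    show V₂.integrand z = _
    show s₁.integrand z * m₂ z = _
    rw [key z hz, glit_one, pow_zero, pow_one, map_mul, MvPolynomial.aeval_C, eq_ratCast, mul_div_assoc, hGw, hm₂, hGz,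
      hTv, hℓκ, affB_neg', hκxv, hτz, hD]
    simp only [hyz, hxz] at hne1 hne2 h0 ⊢
    push_cast
    field_simp
    ring
  -- (6) shear (and reflect if `s < 0`) the letter `τ` to `0`: a THICK parallel band
  obtain ⟨μ, hμ, hμs⟩ : ∃ μ : ℚ, (μ = 1 ∨ μ = -1) ∧ 0 < μ * u.1 (Fin.last B) := by
    rcases lt_or_gt_of_ne hu with h | h
    · exact ⟨-1, Or.inr rfl, by nlinarith⟩
    · exact ⟨1, Or.inl rfl, by nlinarith⟩
  have hμ0 : μ ≠ 0 := by rcases hμ with rfl | rfl <;> norm_num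
  obtain ⟨s₅, -, hbd₅, hdom₅, hint₅, hrel₅⟩ := pull (fun _ : Fin 1 => μ) (fun _ => Tf.1 (Fin.last B))
    (fun _ => restr B Tf) V₃ M₃ L e (MvPolynomial.C (-1 : ℚ) * p₃) ℓ₁ ℓκ 0 1 (fun _ => some Tf) (fun _ => Sum.inr yloF)
    (fun _ => Sum.inr yhiF) hbd₃ hdom₃ hint₃ (fun _ => hμ0) (fun i j hij => by rcases hij with h | h <;> cases h)
  have ha₅ : pullA (fun _ : Fin 1 => μ) (fun _ => Tf.1 (Fin.last B)) (fun _ => restr B Tf) (fun _ => some Tf) =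
      fun _ => some 0 := by
    funext i; simp [pullA, pullC_self']
  rw [ha₅] at hint₅
  -- the new bounds
  set loN : (Fin (B + 1) → ℚ) × ℚ := μ⁻¹ • ((if 0 < μ then yloF else yhiF) - Tf) with hloN
  set hiN : (Fin (B + 1) → ℚ) × ℚ := μ⁻¹ • ((if 0 < μ then yhiF else yloF) - Tf) with hhiN
  have hlo₅ : pullLo (fun _ : Fin 1 => μ) (fun _ => Tf.1 (Fin.last B)) (fun _ => restr B Tf) (fun _ => Sum.inr yloF)
      (fun _ => Sum.inr yhiF) = fun _ => Sum.inr loN := by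
    funext i
    rw [hloN]
    simp only [pullLo]
    split_ifs <;> simp [pullC_restr]
  have hhi₅ : pullHi (fun _ : Fin 1 => μ) (fun _ => Tf.1 (Fin.last B)) (fun _ => restr B Tf) (fun _ => Sum.inr yloF)
      (fun _ => Sum.inr yhiF) = fun _ => Sum.inr hiN := by
    funext i
    rw [hhiN]
    simp only [pullHi]
    split_ifs <;> simp [pullC_restr]
  rw [hlo₅, hhi₅] at hdom₅
  refine good_of_split hsplit ⟨KZ.of V₁, AddSubgroup.subset_closure hV₁mem, by simp⟩ ?_
  suffices h₅ : ∃ c ∈ AddSubgroup.closure (GGset B 2 1), KZ.of s₅ - c ∈ KZ.relations by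
    obtain ⟨c₀, hc₀, hc₀'⟩ := h₅
    refine ⟨c₀, hc₀, ?_⟩
    have : KZ.of V₂ - c₀ = (KZ.of V₂ - KZ.of V₃) + (KZ.of V₃ - KZ.of s₅) + (KZ.of s₅ - c₀) := by abel
    rw [this]
    exact add_mem (add_mem hrel₂ hrel₅) hc₀'
  rcases hμ with rfl | rfl
  · -- `s > 0`: `μ = 1`, the fibre `y` sheared by `τ`
    have hsq : 0 < u.1 (Fin.last B) := by simpa using hμs
    have hsp : 0 < sR := by rw [hsR]; exact_mod_cast hsq
    have hloN' : loN = yloF - Tf := by rw [hloN, if_pos one_pos, inv_one, one_smul]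
    have hhiN' : hiN = yhiF - Tf := by rw [hhiN, if_pos one_pos, inv_one, one_smul]
    refine good_parThick L e ℓ₁ ℓκ 0 1 s₅ M₃ _ loN hiN (Or.inl rfl) hbd₅ hdom₅ hint₅ (fun w hw => ?_)
      ⟨η, hη0, fun w hw => ?_⟩
    · obtain ⟨h0, hY, -⟩ := (hrows₃ w).1 hw
      obtain ⟨-, hf⟩ := (hfl w h0)
      have hf' := ((hfl w h0).1 hsq)
      rw [hloN', hhiN', affF_sub'', affF_sub'', hyloF, hyhiF, affF_liftB, affF_liftB, hTv]
      refine ⟨?_, by linarith [hne w h0]⟩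
      have : affB B 1 ylo w - -(w (Fin.castAdd 1 (Fin.last B)) + affB B 1 (restr B u) w) / sR =
          (w (Fin.castAdd 1 (Fin.last B)) + (sR * affB B 1 ylo w + affB B 1 (restr B u) w)) / sR := by
        field_simp
        ring
      rw [this]
      exact div_pos (by linarith) hsp
    · obtain ⟨h0, -, -⟩ := (hrows₃ w).1 hw
      rw [hloN', hhiN', affF_sub'', affF_sub'', hyloF, hyhiF, affF_liftB, affF_liftB]
      linarith [hη' w h0]
  · -- `s < 0`: `μ = −1`, the fibre `y` sheared by `τ` and reflected
    have hsq : u.1 (Fin.last B) < 0 := by linarith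
    have hsn : sR < 0 := by rw [hsR]; exact_mod_cast hsq
    have hneg1 : ¬ (0 : ℚ) < -1 := by norm_num
    have hloN' : loN = -(yhiF - Tf) := by rw [hloN, if_neg hneg1, inv_neg, inv_one, neg_smul, one_smul]
    have hhiN' : hiN = -(yloF - Tf) := by rw [hhiN, if_neg hneg1, inv_neg, inv_one, neg_smul, one_smul]
    refine good_parThick L e ℓ₁ ℓκ 0 1 s₅ M₃ _ loN hiN (Or.inl rfl) hbd₅ hdom₅ hint₅ (fun w hw => ?_)
      ⟨η, hη0, fun w hw => ?_⟩
    · obtain ⟨h0, hY, -⟩ := (hrows₃ w).1 hw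
      have hf' := ((hfl w h0).2 hsq)
      rw [hloN', hhiN', affF_neg', affF_neg', affF_sub'', affF_sub'', hyloF, hyhiF, affF_liftB, affF_liftB, hTv]
      refine ⟨?_, by linarith [hne w h0]⟩
      have : -(affB B 1 yhi w - -(w (Fin.castAdd 1 (Fin.last B)) + affB B 1 (restr B u) w) / sR) =
          (w (Fin.castAdd 1 (Fin.last B)) + (sR * affB B 1 yhi w + affB B 1 (restr B u) w)) / (-sR) := by
        field_simp
        ring
      rw [this]
      exact div_pos (by linarith) (neg_pos.2 hsn)
    · obtain ⟨h0, -, -⟩ := (hrows₃ w).1 hw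
      rw [hloN', hhiN', affF_neg', affF_neg', affF_sub'', affF_sub'', hyloF, hyhiF, affF_liftB, affF_liftB]
      linarith [hη' w h0]

end Near

end RebasePos

/-- **Registered part of `stub_rebaseSimplePosOne`, residual hypothesis `Hpar` (line
`janus-bands`, v6.2): THIN parallel bands, sub-case (B2), by dominated partial fractions and a
re-selection of the distinguished coordinate.** The data of `Hpar` (one lettered fibre over a
base of dimension `B + 1`, letter `0`, affine bounds `0 < u < v` parallel in `y` with common
slope `u_y ≠ 0`, base pole `1/(y − ℓ₂(x'))` of order one), PLUS: the base cell is a product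
`{x'-rows M₀} × (ylo(x'), yhi(x'))` (`hsec`), its `y`-range is non-pinching (`hη`), and the pole
`ℓ₂` lies ABOVE the `y`-range if `u_y > 0`, BELOW it if `u_y < 0` (`hnear`, the side condition
(B2): `y` is always between `ℓ₂` and the sheared letter). THEN `[s]` is congruent modulo
`KZ.relations` to the subgroup generated by the literal class `GG B 2 1`
(`RebasePos.good_parNear`: shear, dominated partial fractions, one literal piece, coordinate swap
`y ↔ t'` of the other piece into a THICK parallel band, shear/reflection, `good_parThick`; rules
1a, 1b, 2, every intermediate representation absolutely convergent). -/
theorem rebaseSimplePos_par_thin_near (B m m' m₀ : ℕ) (s : KZ.IntegralRep (B + 1 + 1)) (M : Fin m' → (Fin (B + 1) → ℚ) × ℚ) (M₀ : Fin m₀ → (Fin B → ℚ) × ℚ) (ylo yhi : (Fin B → ℚ) × ℚ) (L : Fin m → (Fin B → ℚ) × ℚ) (e : Fin m → ℕ) (p : MvPolynomial (Fin B) ℚ) (ℓ₁ ℓ₂ : (Fin B → ℚ) × ℚ) (u v : (Fin (B + 1) → ℚ) × ℚ) (hbd : Bornology.IsBounded s.domain) (hdom : s.domain = SeparatePos.gDom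 B 1 m' M (fun _ => Sum.inr u) (fun _ => Sum.inr v)) (hint : Set.EqOn s.integrand (RebasePos.glit B 1 p L e ℓ₁ ℓ₂ 0 1 (fun _ => some 0)) s.domain) (hu : u.1 (Fin.last B) ≠ 0) (hpar : u.1 (Fin.last B) = v.1 (Fin.last B)) (hcell : ∀ z : Fin (B + 1 + 1) → ℝ, (∀ j, 0 < SeparatePos.affF B 1 (M j) z) → 0 < SeparatePos.affF B 1 u z ∧ SeparatePos.affF B 1 u z < SeparatePos.affF B 1 v z) (hsec : ∀ z : Fin (B + 1 + 1) → ℝ, (∀ j, 0 < SeparatePos.affF B 1 (M j) z) ↔ ((∀ j, 0 < SeparatePos.affB B 1 (M₀ j) z) ∧ SeparatePos.affB B 1 ylo z < z (Fin.castAdd 1 (Fin.last B)) ∧ z (Fin.castAdd 1 (Fin.last B)) < SeparatePos.affB B 1 yhi z)) (hη : ∃ η : ℝ, 0 < η ∧ ∀ z : Fin (B + 1 + 1) → ℝ, (∀ j, 0 < SeparatePos.affB B 1 (M₀ j) z) → η ≤ SeparatePos.affB B 1 yhi z - SeparatePos.affB B 1 ylo z) (hnear : ∀ z : Fin (B + 1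 + 1) → ℝ, (∀ j, 0 < SeparatePos.affB B 1 (M₀ j) z) → (0 < u.1 (Fin.last B) → SeparatePos.affB B 1 yhi z ≤ SeparatePos.affB B 1 ℓ₂ z) ∧ (u.1 (Fin.last B) < 0 → SeparatePos.affB B 1 ℓ₂ z ≤ SeparatePos.affB B 1 ylo z)) : ∃ c ∈ AddSubgroup.closure (SeparatePos.GGset B 2 1), KZ.of s - c ∈ KZ.relations :=
  RebasePos.good_parNear L e ℓ₁ ℓ₂ s M M₀ ylo yhi p u v hbd hdom hint hu hpar hcell hsec hη hnear

end Summit.KontsevichZagierPeriods.ArrangementNormalForm.JanusBands
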